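import Mathlib.Algebra.MvPolynomial.Basic
import Mathlib.Data.Fintype.BigOperators
import Summits.ValiantsHypothesis.ValiantsHypothesis.Theorems.GrenetZeonHessianRankCodimTwoLatinPlaneDefs
import HarnessLib

/-!
# The Latin block plane, `r = 0`: the normalised permanent / block TABLES (definitions)

Vocabulary for part B ("table identity") of the formalisation of Theorem P for the crux
`GrenetZeon.HessianRankCodimTwo` (stmt-ValiantsHypothesis-8061, line `good_plane`,
`Cruxes/HessianRankCodimTwo/GoodPlanesLatinReduction.md` §6, §8), shared by the seats 8061-p2
(part C), 8061-p3 (part A), 8061-p4 (part B):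

* `rowBlock p r = ⌊r/p⌋ ∈ Fin 3`, the block of a row/column index `r < 3p` (so that the entry
  `(r, c)` of the Latin block point is `a_{rowBlock c − rowBlock r}`, cf. `dIdx`);
* `permTable p` (`Φ̃_p`): the sum over the COLOURINGS `u : Fin 3p → Fin 3` using every value exactly
  `p` times of `Π_r X_{u r − rowBlock r}` — the permanent of the Latin point is `(p!)³ · permTable`
  (`…LatinTable.lean`), and `permTable` is the coefficient of `y^{(p,p,p)}` in `Π_I ℓ_I(y)^p` for the
  circulant row forms `ℓ_I(y) = Σ_J X_{J−I} y_J`;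
* `blockTable p hp I J` (`η̃_{IJ}`): the same sum over colourings of the rows OTHER than the two
  removed rows `I·p, I·p+1`, with value `J` used `p − 2` times and the other two values `p` times —
  the block value `h_{IJ}` of the Latin point is `(p−2)!·p!·p! · blockTable` (`…LatinBlockTable.lean`),
  and `blockTable` is the coefficient of `y^{(p,p,p)−2e_J}` in `ℓ_I^{p−2} Π_{I'≠I} ℓ_{I'}^p`.

Nothing is proved here, and nothing here moves VP ≠ VNP (the crux feeds only the constant-factor
bound `TwoDimCoefficients`; this is bookkeeping inside the family `n = 3p`).
-/

noncomputable section

open MvPolynomial Finset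

-- single-conjunct layout `Summits/ValiantsHypothesis/ValiantsHypothesis`: duplicated namespace by design
set_option linter.dupNamespace false

namespace Summit.ValiantsHypothesis.ValiantsHypothesis.Theorems.GrenetZeonHessianRankCodimTwo

/-- The block index of a row/column index `r < 3p`: `⌊r / p⌋ ∈ {0, 1, 2}`. [folklore] -/
def rowBlock (p : ℕ) (r : Fin (3 * p + 0)) : Fin 3 :=
  ⟨r.val / p, by
    have hr := r.isLt
    rcases Nat.eq_zero_or_pos p with h | h
    · omega
    · exact (Nat.div_lt_iff_lt_mul h).mpr (by omega)⟩

/-- **The (normalised) permanent table `Φ̃_p`.** Sum over the colourings `u : rows → Fin 3` using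
every column block exactly `p` times of the monomials `Π_r X_{u r − rowBlock r}`; equals
`per(latinPoint)/(p!)³` as a polynomial and the coefficient of `y₀^p y₁^p y₂^p` in `Π_I ℓ_I(y)^p`
for the circulant row forms `ℓ_I = Σ_J X_{J−I} y_J`. [folklore] -/
def permTable (p : ℕ) : MvPolynomial (Fin 3) ℤ :=
  ∑ u ∈ univ.filter (fun u : Fin (3 * p + 0) → Fin 3 => ∀ K, Fintype.card {r // u r = K} = p),
    ∏ r, X (u r - rowBlock p r)

/-- **The (normalised) block table `η̃_{IJ}`.** Sum over the colourings `u` of the rows other than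
the two removed rows `I·p, I·p+1` of block `I`, using column block `J` exactly `p − 2` times and
the other two column blocks `p` times each, of the monomials `Π_r X_{u r − rowBlock r}`; equals the
block value `h_{IJ}(latinPoint)/((p−2)!·p!·p!)` as a polynomial and the coefficient of
`y^{(p,p,p) − 2e_J}` in `ℓ_I^{p−2} Π_{I'≠I} ℓ_{I'}^p`. [folklore] -/
def blockTable (p : ℕ) (hp : 2 ≤ p) (I J : Fin 3) : MvPolynomial (Fin 3) ℤ :=
  ∑ u ∈ univ.filter
      (fun u : {r : Fin (3 * p + 0) // r ≠ blockIdx p 0 hp I 0 ∧ r ≠ blockIdx p 0 hp I 1} → Fin 3 =>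
        ∀ K, Fintype.card {r // u r = K} = if K = J then p - 2 else p),
    ∏ r, X (u r - rowBlock p r.1)

end Summit.ValiantsHypothesis.ValiantsHypothesis.Theorems.GrenetZeonHessianRankCodimTwo
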